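import Mathlib.AlgebraicGeometry.ValuativeCriterion
import Mathlib.AlgebraicGeometry.Cover.Open
import HarnessLib

/-!
# Points of a scheme with values in a local ring or a valuation ring

Topic: `Literature/AlgebraicGeometry/Smoothening` (Bosch–Lütkebohmert–Raynaud, *Néron Models*,
§1.1 and §3.5: the `R'`-valued points of a proper `R`-model, for discrete valuation rings
`R ⊆ R'`, are the `K'`-valued points of its generic fibre — valuative criterion — and each of them
factors through an affine open chart). Two elementary facts, from Mathlib's valuative criterion
and open immersions:

* `exists_lift_of_isProper` / `lift_unique_of_isSeparated` — for `f : X → Y` proper and a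
  valuation ring `O` with fraction field `L`, every commutative square `Spec L → X`, `Spec O → Y`
  has a (unique) diagonal `Spec O → X` (Mathlib `IsProper.eq_valuativeCriterion`);
* `exists_lift_of_closedPoint_mem`, `exists_lift_openCover` — a morphism `Spec S → X` from the
  spectrum of a local ring factors through every open immersion whose image contains the image
  of the closed point, in particular through a member of any open cover (every point of `Spec S`
  specialises to the closed point).

[folklore]; no named facts (D-0026).

## References

* S. Bosch, W. Lütkebohmert, M. Raynaud, *Néron Models*, Springer 1990, §1.1, §3.5.
  [BLRNeronModels1990] (Not held; numbers only.)
* The Stacks Project, Tags 0BX5 (valuative criterion of properness), 01KE. [StacksProject]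
-/

noncomputable section

open CategoryTheory AlgebraicGeometry IsLocalRing

namespace Literature.AlgebraicGeometry.Smoothening

universe u

/-! ### Valuation-ring points of proper schemes -/

section Valuative

variable {X Y : Scheme.{u}} (f : X ⟶ Y) (O : Type u) [CommRing O] [IsDomain O] [ValuationRing O]
  (L : Type u) [Field L] [Algebra O L] [IsFractionRing O L]
  (i₁ : Spec (.of L) ⟶ X) (i₂ : Spec (.of O) ⟶ Y)

/-- **Valuative criterion of properness, existence and uniqueness of the lift**: for `f : X → Y`
proper, `O` a valuation ring with fraction field `L`, and a commutative square
`Spec L → X → Y = Spec L → Spec O → Y`, there is a unique `Spec O → X` making both triangles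
commute. [cite: StacksProject, Tag 0BX5] -/
theorem existsUnique_lift_of_isProper [IsProper f]
    (w : i₁ ≫ f = Spec.map (CommRingCat.ofHom (algebraMap O L)) ≫ i₂) :
    ∃! l : Spec (.of O) ⟶ X, Spec.map (CommRingCat.ofHom (algebraMap O L)) ≫ l = i₁ ∧ l ≫ f = i₂ := by
  have hf : ValuativeCriterion f := by
    have h : (ValuativeCriterion ⊓ @QuasiCompact ⊓ @QuasiSeparated ⊓ @LocallyOfFiniteType) f := by
      rw [← IsProper.eq_valuativeCriterion]; infer_instance
    exact h.1.1.1
  obtain ⟨hU⟩ := hf ⟨O, L, i₁, i₂, ⟨w⟩⟩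
  refine ⟨hU.default.l, ⟨hU.default.fac_left, hU.default.fac_right⟩, fun l hl => ?_⟩
  have := hU.uniq ⟨l, hl.1, hl.2⟩
  exact congrArg CommSq.LiftStruct.l this

/-- **Valuative criterion of properness, existence of the lift.** [cite: StacksProject, Tag 0BX5] -/
theorem exists_lift_of_isProper [IsProper f]
    (w : i₁ ≫ f = Spec.map (CommRingCat.ofHom (algebraMap O L)) ≫ i₂) :
    ∃ l : Spec (.of O) ⟶ X, Spec.map (CommRingCat.ofHom (algebraMap O L)) ≫ l = i₁ ∧ l ≫ f = i₂ :=
  (existsUnique_lift_of_isProper f O L i₁ i₂ w).exists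

/-- **Valuative criterion of separatedness, uniqueness of the lift**: two `O`-points of a
separated `Y`-scheme with the same generic point and the same image in `Y` coincide.
[cite: StacksProject, Tag 01KY] -/
theorem lift_unique_of_isSeparated [IsSeparated f]
    (w : i₁ ≫ f = Spec.map (CommRingCat.ofHom (algebraMap O L)) ≫ i₂)
    (l₁ l₂ : Spec (.of O) ⟶ X)
    (h₁ : Spec.map (CommRingCat.ofHom (algebraMap O L)) ≫ l₁ = i₁) (h₁' : l₁ ≫ f = i₂)
    (h₂ : Spec.map (CommRingCat.ofHom (algebraMap O L)) ≫ l₂ = i₁) (h₂' : l₂ ≫ f = i₂) :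
    l₁ = l₂ := by
  have hs := IsSeparated.valuativeCriterion (f := f) ⟨O, L, i₁, i₂, ⟨w⟩⟩
  have := hs.elim ⟨l₁, h₁, h₁'⟩ ⟨l₂, h₂, h₂'⟩
  exact congrArg CommSq.LiftStruct.l this

end Valuative

/-! ### Local-ring points factor through open neighbourhoods of the closed point -/

section Local

variable {S : Type u} [CommRing S] [IsLocalRing S] {X Y : Scheme.{u}}

/-- The image of `Spec S → X`, `S` local, lies in every open containing the image of the closed
point (every point of `Spec S` specialises to the closed point). [folklore] -/
theorem range_subset_of_closedPoint_mem (g : Spec (.of S) ⟶ X) {U : Set X} (hU : IsOpen U)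
    (h : g.base (closedPoint S) ∈ U) : Set.range g.base ⊆ U := by
  rintro _ ⟨p, rfl⟩
  exact ((specializes_closedPoint p).map g.base.hom.continuous).mem_open hU h

/-- **A local-ring point factors through an open immersion containing its closed point.**
[folklore] -/
theorem exists_lift_of_closedPoint_mem (f : Y ⟶ X) [IsOpenImmersion f] (g : Spec (.of S) ⟶ X)
    (h : g.base (closedPoint S) ∈ Set.range f.base) : ∃ l : Spec (.of S) ⟶ Y, l ≫ f = g :=
  ⟨IsOpenImmersion.lift f g (range_subset_of_closedPoint_mem g (IsOpenImmersion.isOpen_range f) h),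
    IsOpenImmersion.lift_fac _ _ _⟩

/-- **A local-ring point factors through a member of any open cover.** [folklore] -/
theorem exists_lift_openCover (𝒰 : X.OpenCover) (g : Spec (.of S) ⟶ X) :
    ∃ (j : 𝒰.I₀) (l : Spec (.of S) ⟶ 𝒰.X j), l ≫ 𝒰.f j = g :=
  ⟨𝒰.idx (g.base (closedPoint S)), exists_lift_of_closedPoint_mem (𝒰.f _) g (𝒰.covers _)⟩

end Local

end Literature.AlgebraicGeometry.Smoothening

end
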